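/- Copyright: the b2b-balaban cell (near-miss cell 7), T⁴-continuum fan-out, row-NE7b OWNER lineage `t4-ne7b-p1`
(gen 100 sketch; gen 101 v2 «LATTICE LETTER») — (α)-instance, (A3) module J3, STATEMENT FIRST: the per-step display `hw`
IN PINNED SHAPE (suppression exponentials of the count road's sharp-exponent letters; the volume exponential AT THE END
RECORD's OWN LATTICE-UNIT LETTER `uvolL`).  PART A = shape + display + END (sibling PART B `B16HistoryStepDisplayValuations` =
printed valuations + junction facts).  INTERFACE REQUEST NE7b IR-100-1 (A).  Released under the licence of the surrounding project. -/
import Summits.QuantumFields.BalabanUV.T4Continuum.Support.B16HistoryReprReadCausal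
import Summits.QuantumFields.BalabanUV.T4Continuum.Support.HistoryBankingCreditRead
import Summits.QuantumFields.BalabanUV.T4Continuum.Support.HistoryBankingVolumeWindowLattice

/-!
# (α)-INSTANCE, (A3) module J3, PART A — STATEMENT FIRST: J2b's per-step unit-weight display `hw` IN PINNED SHAPE,
volume letter IN LATTICE UNITS (v2 of the owner's IR-100-1 (A); ruling R-ne7bp1-g101-1)

Summits-side support leaf of the T⁴-continuum cell (rung (B)+1 on a FINITE torus only; NOT infinite volume, NOT the
mass gap, NOT Clay; NOT a proof of NE7b — the cell's OWN estimate `T4WeightBudget.RelWeightBound`, NOT PRINTED, NOT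
PROVED).  [folklore] real arithmetic + compositions over J2b (`B16HistoryReprReadCausal`: `StepReading`, `wStep`,
`histRead_tower_of_hw`, `weight_le_evProd_of_hw`), J1 (`B16HistoryReprRead.factorsOf`), IR-97-2 (`Tower`, `skelFam`,
`reprFam`), M5-3 (`HistoryBankingCreditRead.FactorRead`) and M5-2's lattice letter (`HistoryBankingVolumeWindowLattice.uvolL`);
nothing printed is asserted, no `def … : Prop` FACT of Bałaban's (the one `Prop` below, `HwPinned`, is a HYPOTHESIS SHAPE
over an ABSTRACT tower and an ABSTRACT step reading — which tower and which reading are Bałaban's is (A1c)), no cite-tagged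
hypothesis, zero `sorry`.  [Balaban1989LargeFieldII] p. 380 l. 12–18, p. 381 l. 1–4, p. 383 and (1.79), p. 384 l. 4–6
are quoted as LOCATORS only.

WHY (R-g54-1).  After J1 ∕ J2a ∕ J2b the reading slot `hR : HistRead` of the count road is a theorem for a tower-form run
GIVEN ONE per-step display `hw : op_j(g,p) 1 ≤ 𝒮.wStep fB fR Λ K j g p` at FREE factor values.  HERE (§1) the values are
pinned IN SHAPE to the letters the COUNT ROAD ALREADY CONSUMES: `fB := exp(−sB K ℓ d′)`, `fR := exp(−sR K h)` — `sB`, `sR` the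
sharp-exponent letters of M5-3's `FactorRead` ∕ `RoundingRoom` — and, per `M·R_ℓ`-cube of a level-`ℓ` component of run `K`,
`Λ K ℓ := exp (uvolL cΛ M d (gs K) (𝒮.R K) K ℓ) = exp (cΛ·(M·R_{ℓ∧K})^d·ℓ_{ℓ∧K})` — THE END RECORD's OWN VOLUME LETTER
(`HistoryRealiseCellsRunAssemblyWTVSDataLWL.HistReadDataLWL.hΛL : log (Φf.Λ K t) = uvolL cΛ M d g (ℛ.R K) K t`, currency (B)
of R-OWNER-49-2; [B16] p. 380 l. 12–18 FIRST form «every large field domain Z_j contributes the constant O(1) log g_j⁻²|Z_j|»,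
LOCATOR).  So `FactorRead` holds BY `rfl` (`factorRead_pinned`), the END's `hΛL` holds BY `Real.log_exp` (`log_Λ_factorsPinned`),
and the R-road keeps exactly TWO letter junctions: `HwPinned T 𝒮 sB sR cΛ M gs K₀` (this file's `Prop`, (A1c)'s to inhabit for
Bałaban's tower) and `RoundingRoom … sB sR` (an inequality between letters — calc's).

WHY v2 (located owner finding F-ne7bp1-g101-1, kernel-visible).  The gen-100 sketch pinned the volume letter at (1.79)'s
SECOND form `exp(cΛ·M^d·R_ℓ^{d+1})` per cube (p. 380 l. 12–18's chain «O(1) log g_j⁻²|Z_j| ≦ O(1) log g_j⁻²(MR_j)^d d′_j(Z_j) ≦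
O(1)M^dR_j^{d+1}d′_j(Z_j)» read at its LAST member).  That letter cannot meet the END record's `hΛL` (an EQUALITY with
`uvolL`'s `(M·R_t)^d·ℓ_t`: the two exponents differ by the factor `R_t ∕ (M^0·ℓ_t)`, unbounded along the flow), and it is the
WEAKER printed form; IR-100-2's `B16StepFactorsPrinted.StepDisplaysAt` (V) keeps the FIRST form `O(1) log g_j⁻²|Z_j|` — the same
currency as `uvolL`.  v2 therefore pins `Λ` AT `exp ∘ uvolL`: J4-c («(V)(I)(F)(P) at the process carriers ⟹ `HwPinned`») becomes a
regrouping in ONE currency (its only flow input is `1 ≤ ℓ_t` on the performed range, for the A_j-integral constant — Q-J3-1),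
and the END consumes the pinned bundle's `Λ` verbatim.  The (1.79) second form stays what it is in print: a weakening used
to write (1.80), typed in `B16Ineq179` ∕ `B16StepFactorsPrinted.stepFactor179_le`; nothing here contradicts it.

THE DISPLAY `HwPinned T 𝒮 sB sR cΛ M gs K₀` (§2): for every run `K ≥ K₀`, step `j`, prefix `g`, choice `p` and EVERY
level-`(j+1)` configuration `x`, `((T K).op j g p).T 1 x ≤ 𝒮.wStep (fBexp sB) (fRexp sR) (ΛexpL cΛ M d gs 𝒮.R) K j g p`: the
unit weight of the step map is at most the product, over the level-`(j+1)` components the step forms, of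
`exp(uvolL cΛ M d (gs K) (𝒮.R K) K (j+1))` per cube × `exp(−sR K j)` per part renewed by the level-`j` 𝐑-operation ×
`exp(−sB K (j+1) d′)` per new region of class `d′` — (1.79) p. 383 READ PER OPERATION with p. 384 l. 4–6's factorisation, the
volume constant in p. 380's first form.  HONEST LIMITS, stated once: (β) universal in `j` (J1's interface forces it) — (A1c)
sets `op j g p := 0` past the cutoff ∕ off the admissible branch (there `uvolL`'s cap at `K` is idle); (x) UNIFORM IN `x`,
while print states per-step factors for backgrounds inside the accumulated small-field ∕ analyticity domains — (A1c) folds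
the characteristic function of the choice's admissible level-`(j+1)` domain into `op j g p`; only then is the uniform display
print's on-domain statement (refuter F286 (iii)).

QUESTIONS LEFT STANDING (zero weight): Q-J3-1 — which O(1)'s ride in `cΛ` (vacuum-energy `cV` + A_j-integral `cA`; the
second needs `1 ≤ ℓ_t` on the performed range); Q-J3-2 — the birth letter (PART B: p. 381's LEFT member, never (1.79)'s face
value); Q-J3-3 — the class map `𝒮.κ`.  NOT HERE (honest): Bałaban's tower `T` and step reading `𝒮` as Lean objects ((A1c));
any proof of `HwPinned` for them; any value of any letter; M5; any estimate.  BY-NAME EFFECT ON THE WALL (`WALL-NE7b-P1.md`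
§2): NONE — R2's class is unchanged («reading»); what changes is that R2 is ONE NAMED `Prop` in the count road's own letters,
`FactorRead` is discharged by `rfl`, the END's `hΛL` by `Real.log_exp`.  HONEST DEPENDENCY (cell): continuum YM on T⁴ ⇐
BetaPertH ∧ nine spine estimates (0/9 proved); BetaPertH ⇐ (D1) ∧ (D4) ∧ CAP+tail; G-an2-4 gates asym, D1 and NE2/3/4.
This file changes none of it.
-/

open Finset MeasureTheory
open Literature.MathematicalPhysics.QuantumFieldTheory.Balaban1983to89
open Literature.MathematicalPhysics.QuantumFieldTheory.Balaban1983to89.B13ScaleTransfer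
open Literature.MathematicalPhysics.QuantumFieldTheory.Balaban1983to89.TreeLength
open Literature.MathematicalPhysics.QuantumFieldTheory.Balaban1983to89.B16MergeGeometry
open Summit.QuantumFields.BalabanUV.T4Continuum.HistoryAdmissible
open Summit.QuantumFields.BalabanUV.T4Continuum.HistoryGen
open Summit.QuantumFields.BalabanUV.T4Continuum.HistoryGenealogyExtraction
open Summit.QuantumFields.BalabanUV.T4Continuum.HistoryGenealogyRealise
open Summit.QuantumFields.BalabanUV.T4Continuum.HistoryGenealogyInstantiate
open Summit.QuantumFields.BalabanUV.T4Continuum.HistoryGenealogyPedigree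
open Summit.QuantumFields.BalabanUV.T4Continuum.HistoryRealiseWeakCells
open Summit.QuantumFields.BalabanUV.T4Continuum.HistoryTouchComponents

namespace Summit.QuantumFields.BalabanUV.T4Continuum.B16HistoryStepDisplayPinned

open Summit.QuantumFields.BalabanUV.T4Continuum.B16HistoryIndexedRepr
open Summit.QuantumFields.BalabanUV.T4Continuum.B16HistoryReprChain
open Summit.QuantumFields.BalabanUV.T4Continuum.B16HistoryReprInstance
open Summit.QuantumFields.BalabanUV.T4Continuum.B16HistoryReprRead
open Summit.QuantumFields.BalabanUV.T4Continuum.B16HistoryReprReadCausal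
open Summit.QuantumFields.BalabanUV.T4Continuum.HistoryBankingCreditRead
open Summit.QuantumFields.BalabanUV.T4Continuum.HistoryBankingSharpShares (ell)
open Summit.QuantumFields.BalabanUV.T4Continuum.HistoryBankingVolumeWindowLattice (uvolL)

noncomputable section

/-! ## §1 The pinned SHAPE of the three factor kinds (real-valued abbreviations; nothing asserted) -/

section Shape

variable {d : ℕ} (sB : ℕ → ℕ → ℕ → ℝ) (sR : ℕ → ℕ → ℝ)

/-- **THE PINNED BIRTH FACTOR** of a new large-field region `n` of class `d′` booked at level `ℓ` of run `K`:
`exp (−sB K ℓ d′)` — the suppression exponential of the count road's sharp birth-exponent letter (M5-3's `FactorRead.fB_le`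
is then `le_rfl`); the region enters only through its class.  Printed valuations of `sB`: PART B. [folklore] -/
def fBexp (K ℓ d' : ℕ) (_n : Lab d) : ℝ := Real.exp (-sB K ℓ d')

/-- **THE PINNED RENEWAL FACTOR** of a part renewed by the level-`h` 𝐑-operation of run `K`: `exp (−sR K h)` — the
suppression exponential of the count road's sharp renewal-exponent letter.  Printed valuations of `sR`: PART B. [folklore] -/
def fRexp (K h : ℕ) : ℝ := Real.exp (-sR K h)

/-- **THE PINNED PER-CUBE VOLUME COST AT THE END RECORD's LATTICE LETTER**: for run `K` with coupling sequence `gs K` and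
sizes `R K`, level `t`: `exp (uvolL cΛ M d (gs K) (R K) K t) = exp (cΛ·(M·R_{t∧K})^d·ℓ_{t∧K})`, `ℓ_j = log g_j⁻²` — [B16]
p. 380 l. 12–18, FIRST form «every large field domain Z_j contributes the constant O(1) log g_j⁻²|Z_j|» per `M·R_j`-cube
(`|cube| = (M·R_j)^d` sites), LOCATOR; `cΛ` the O(1) (Q-J3-1), `M` print's block constant; capped at the cutoff as the letter
is (idle inside a run: `t ≤ K`).  An abbreviation. [folklore] -/
def ΛexpL (cΛ M : ℝ) (d : ℕ) (gs : ℕ → ℕ → ℝ) (R : ℕ → ℕ → ℕ) (K t : ℕ) : ℝ :=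
  Real.exp (uvolL cΛ M d (gs K) (R K) K t)

/-- the pinned birth factor is non-negative [folklore] -/
theorem fBexp_nonneg (K ℓ d' : ℕ) (n : Lab d) : 0 ≤ fBexp sB K ℓ d' n := (Real.exp_pos _).le

/-- the pinned renewal factor is non-negative [folklore] -/
theorem fRexp_nonneg (K h : ℕ) : 0 ≤ fRexp sR K h := (Real.exp_pos _).le

/-- the pinned birth factor is a suppression (`≤ 1`) exactly where the exponent letter is non-negative [folklore] -/
theorem fBexp_le_one_iff (K ℓ d' : ℕ) (n : Lab d) : fBexp sB K ℓ d' n ≤ 1 ↔ 0 ≤ sB K ℓ d' := by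
  unfold fBexp
  rw [Real.exp_le_one_iff, neg_nonpos]

/-- the pinned renewal factor is a suppression exactly where the exponent letter is non-negative [folklore] -/
theorem fRexp_le_one_iff (K h : ℕ) : fRexp sR K h ≤ 1 ↔ 0 ≤ sR K h := by
  unfold fRexp
  rw [Real.exp_le_one_iff, neg_nonpos]

variable (cΛ M : ℝ) (gs : ℕ → ℕ → ℝ) (R : ℕ → ℕ → ℕ)

/-- **THE LOGARITHM OF THE PINNED VOLUME COST IS THE LATTICE LETTER** — the END record's `hΛL` shape, by `Real.log_exp`.
[folklore] -/
theorem log_ΛexpL (K t : ℕ) : Real.log (ΛexpL cΛ M d gs R K t) = uvolL cΛ M d (gs K) (R K) K t := Real.log_exp _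

/-- the lattice letter is non-negative for `cΛ, M ≥ 0` and couplings at most one on the performed range (`0 ≤ ℓ_j`, `j ≤ K`)
— one notch weaker than the supplier's `uvolL_nonneg` (`1 ≤ ℓ_j`). [folklore] -/
theorem uvolL_nonneg_of_ell_nonneg {g : ℕ → ℝ} {R₁ : ℕ → ℕ} {K : ℕ} (hc : 0 ≤ cΛ) (hM : 0 ≤ M)
    (hℓ : ∀ j, j ≤ K → 0 ≤ ell g j) (t : ℕ) : 0 ≤ uvolL cΛ M d g R₁ K t :=
  mul_nonneg (mul_nonneg hc (pow_nonneg (mul_nonneg hM (Nat.cast_nonneg _)) _)) (hℓ _ (min_le_right t K))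

/-- **the pinned per-cube cost is at least one** for `cΛ ≥ 0`, `M ≥ 0` and `0 ≤ ℓ_j` on every run's performed range —
M2-B's displayed `one_le_Λ`. [folklore] -/
theorem one_le_ΛexpL (hc : 0 ≤ cΛ) (hM : 0 ≤ M) (hℓ : ∀ K j, j ≤ K → 0 ≤ ell (gs K) j) (K t : ℕ) :
    1 ≤ ΛexpL cΛ M d gs R K t := by
  unfold ΛexpL
  rw [Real.one_le_exp_iff]
  exact uvolL_nonneg_of_ell_nonneg cΛ M hc hM (hℓ K) t

/-- the pinned per-cube cost is monotone in the constant `cΛ` (same side conditions) [folklore] -/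
theorem ΛexpL_mono {cΛ cΛ' : ℝ} (hc : cΛ ≤ cΛ') (hM : 0 ≤ M) (hℓ : ∀ K j, j ≤ K → 0 ≤ ell (gs K) j) (K t : ℕ) :
    ΛexpL cΛ M d gs R K t ≤ ΛexpL cΛ' M d gs R K t := by
  unfold ΛexpL uvolL
  exact Real.exp_le_exp.mpr (mul_le_mul_of_nonneg_right
    (mul_le_mul_of_nonneg_right hc (pow_nonneg (mul_nonneg hM (Nat.cast_nonneg _)) _)) (hℓ K _ (min_le_right t K)))

/-- **THE COUNT ROAD'S FACTOR READING IS MET BY `rfl` IN THE PINNED SHAPE**: M5-3's `FactorRead` (birth factors in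
`[0, e^{−sB}]`, renewal factors in `[0, e^{−sR}]`) for the pinned values of run `K` at the SAME letters `sB K`, `sR K` —
so after this pinning M5-3's companion `RoundingRoom C O L K R g (sB K) (sR K)` is an inequality between letters alone.
[folklore] -/
theorem factorRead_pinned (K : ℕ) : FactorRead (fBexp (d := d) sB K) (fRexp sR K) (sB K) (sR K) where
  fB_nonneg ℓ d' n := fBexp_nonneg sB K ℓ d' n
  fR_nonneg h := fRexp_nonneg sR K h
  fB_le _ _ _ := le_rfl
  fR_le _ := le_rfl

end Shape

/-! ## §2 THE DISPLAY, STATEMENT FIRST -/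

section Display

variable {P : Type} {d : ℕ} {C : ℕ → ℕ → Type} {𝒢 : (K j : ℕ) → GoodClass (C K j)}

/-- **J3 — THE PER-STEP UNIT-WEIGHT DISPLAY IN PINNED SHAPE, VOLUME LETTER IN LATTICE UNITS** (HYPOTHESIS SHAPE over an
abstract tower `T` and an abstract step reading `𝒮`; R-class reading R2 of `WALL-NE7b-P1.md` §2 as ONE named `Prop` in the
count road's own letters `sB`, `sR`, `cΛ`, `M` and the runs' coupling sequences `gs`): for every run `K ≥ K₀`, step `j`,
prefix `g`, choice `p` and EVERY level-`(j+1)` configuration `x`,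
`((T K).op j g p).T 1 x ≤ 𝒮.wStep (fBexp sB) (fRexp sR) (ΛexpL cΛ M d gs 𝒮.R) K j g p` — (1.79) p. 383 READ PER OPERATION with
p. 384 l. 4–6's factorisation over the components the step forms: `exp(cΛ·(M·R_{j+1})^d·ℓ_{j+1})` per cube (p. 380 l. 12–18,
first form), `exp(−sR K j)` per part renewed by the level-`j` 𝐑-operation, `exp(−sB K (j+1) d′)` per new region of class
`d′`; the sizes are THE READING's OWN `𝒮.R K` (the END reads `ℛ.R K`).  Conventions (A1c) must honour: `op j g p := 0` past
the cutoff ∕ off the admissible branch (honest limit (β)); the characteristic function of the choice's admissible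
level-`(j+1)` domain folded into `op j g p` (honest limit (x)).  Which `T`, `𝒮` are Bałaban's, the display for them, and the
values of the letters are (A1c) ∕ calc; nothing asserted. [folklore] -/
def HwPinned (T : (K : ℕ) → Tower P (C K) (𝒢 K)) (𝒮 : StepReading P d) (sB : ℕ → ℕ → ℕ → ℝ) (sR : ℕ → ℕ → ℝ)
    (cΛ M : ℝ) (gs : ℕ → ℕ → ℝ) (K₀ : ℕ) : Prop :=
  ∀ K, K₀ ≤ K → ∀ (j : ℕ) (g : Fin j → P) (p : P) (x : C K (j + 1)),
    ((T K).op j g p).T (fun _ => 1) x ≤ 𝒮.wStep (fBexp sB) (fRexp sR) (ΛexpL cΛ M d gs 𝒮.R) K j g p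

/-- `HwPinned` is monotone in the threshold `K₀` [folklore] -/
theorem HwPinned.mono {T : (K : ℕ) → Tower P (C K) (𝒢 K)} {𝒮 : StepReading P d} {sB : ℕ → ℕ → ℕ → ℝ}
    {sR : ℕ → ℕ → ℝ} {cΛ M : ℝ} {gs : ℕ → ℕ → ℝ} {K₀ K₁ : ℕ} (h : HwPinned T 𝒮 sB sR cΛ M gs K₀) (hK : K₀ ≤ K₁) :
    HwPinned T 𝒮 sB sR cΛ M gs K₁ :=
  fun K hK₁ => h K (hK.trans hK₁)

/-- products of pointwise-dominated non-negative real lists are dominated [folklore] -/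
private theorem prod_map_le_prod_map {ι : Type*} (l : List ι) (f f' : ι → ℝ) (h0 : ∀ i ∈ l, 0 ≤ f i)
    (h : ∀ i ∈ l, f i ≤ f' i) : (l.map f).prod ≤ (l.map f').prod := by
  induction l with
  | nil => simp
  | cons a l ih =>
      simp only [List.map_cons, List.prod_cons]
      have ha0 : 0 ≤ f a := h0 a (by simp)
      have ha : f a ≤ f' a := h a (by simp)
      have hl0 : 0 ≤ (l.map f).prod := List.prod_nonneg fun x hx => by
        obtain ⟨i, hi, rfl⟩ := List.mem_map.mp hx
        exact h0 i (by simp [hi])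
      exact mul_le_mul ha (ih (fun i hi => h0 i (by simp [hi])) fun i hi => h i (by simp [hi])) hl0 (ha0.trans ha)

/-- **`HwPinned` IS MONOTONE IN THE EXPONENT LETTERS**: weakening the sharp exponents (`sB′ ≤ sB`, `sR′ ≤ sR`) or the
volume constant (`cΛ ≤ cΛ′`, with `M ≥ 0` and `0 ≤ ℓ_j` on every performed range) preserves the display — so a display
proved at a SHARP printed valuation serves every booked valuation below it (the direction Q-J3-2 needs). [folklore] -/
theorem HwPinned.of_le {T : (K : ℕ) → Tower P (C K) (𝒢 K)} {𝒮 : StepReading P d} {sB sB' : ℕ → ℕ → ℕ → ℝ}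
    {sR sR' : ℕ → ℕ → ℝ} {cΛ cΛ' M : ℝ} {gs : ℕ → ℕ → ℝ} {K₀ : ℕ} (h : HwPinned T 𝒮 sB sR cΛ M gs K₀)
    (hB : ∀ K ℓ d', sB' K ℓ d' ≤ sB K ℓ d') (hR : ∀ K h', sR' K h' ≤ sR K h') (hc : cΛ ≤ cΛ') (hM : 0 ≤ M)
    (hℓ : ∀ K j, j ≤ K → 0 ≤ ell (gs K) j) (hc0 : 0 ≤ cΛ) :
    HwPinned T 𝒮 sB' sR' cΛ' M gs K₀ := by
  intro K hK j g p x
  refine (h K hK j g p x).trans (Finset.prod_le_prod (fun c _ => ?_) fun c _ => ?_)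
  · exact lf_nonneg _ _ _ (fBexp_nonneg sB) (fRexp_nonneg sR) (one_le_ΛexpL cΛ M gs 𝒮.R hc0 hM hℓ) _ _ K _ c
  unfold lf
  set H := (𝒮.runPartial K (j + 1) (Fin.snoc g p)).histM with hH
  set rnw := (𝒮.runPartial K (j + 1) (Fin.snoc g p)).rnwM with hrnw
  have hRf0 : ∀ s : ℕ → ℕ → ℝ, 0 ≤ H.rfacs rnw (fRexp s K) (j + 1) c := fun s => by
    unfold ComponentHistory.rfacs
    refine List.prod_nonneg fun y hy => ?_
    obtain ⟨q, -, rfl⟩ := List.mem_map.mp hy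
    split_ifs
    · exact fRexp_nonneg s K _
    · exact zero_le_one
  have hBf0 : ∀ s : ℕ → ℕ → ℕ → ℝ,
      0 ≤ ((H.news (j + 1) c).map fun n => fBexp s K (j + 1) (H.cls n) n).prod := fun s =>
    List.prod_nonneg fun y hy => by
      obtain ⟨n, -, rfl⟩ := List.mem_map.mp hy
      exact fBexp_nonneg s K _ _ n
  have hRf1 : H.rfacs rnw (fRexp sR K) (j + 1) c ≤ H.rfacs rnw (fRexp sR' K) (j + 1) c := by
    unfold ComponentHistory.rfacs
    refine prod_map_le_prod_map _ _ _ (fun q _ => ?_) (fun q _ => ?_)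
    · split_ifs
      · exact fRexp_nonneg sR K _
      · exact zero_le_one
    · split_ifs
      · unfold fRexp
        exact Real.exp_le_exp.mpr (neg_le_neg (hR K _))
      · exact le_rfl
  have hBf1 : ((H.news (j + 1) c).map fun n => fBexp sB K (j + 1) (H.cls n) n).prod ≤
      ((H.news (j + 1) c).map fun n => fBexp sB' K (j + 1) (H.cls n) n).prod :=
    prod_map_le_prod_map _ _ _ (fun n _ => fBexp_nonneg sB K _ _ n) fun n _ => by
      unfold fBexp
      exact Real.exp_le_exp.mpr (neg_le_neg (hB K _ _))
  have hΛ0 : 0 ≤ ΛexpL cΛ M d gs 𝒮.R K (j + 1) := zero_le_one.trans (one_le_ΛexpL cΛ M gs 𝒮.R hc0 hM hℓ K _)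
  have hΛ0' : 0 ≤ ΛexpL cΛ' M d gs 𝒮.R K (j + 1) :=
    zero_le_one.trans (one_le_ΛexpL cΛ' M gs 𝒮.R (hc0.trans hc) hM hℓ K _)
  have hΛ1 : ΛexpL cΛ M d gs 𝒮.R K (j + 1) ≤ ΛexpL cΛ' M d gs 𝒮.R K (j + 1) := ΛexpL_mono M gs 𝒮.R hc hM hℓ K _
  exact mul_le_mul (pow_le_pow_left₀ hΛ0 hΛ1 _) (mul_le_mul hRf1 hBf1 (hBf0 sB) (hRf0 sR'))
    (mul_nonneg (hRf0 sR) (hBf0 sB)) (pow_nonneg hΛ0' _)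

end Display

/-! ## §3 THE END BY NAME: `HistRead`, the weight bound and the END record's `hΛL` for the tower with the causal reading AT
THE PINNED FACTORS -/

section End

variable {P : Type} [DecidableEq P] {d : ℕ} {C : ℕ → ℕ → Type} {𝒢 : (K j : ℕ) → GoodClass (C K j)}
  (T : (K : ℕ) → Tower P (C K) (𝒢 K)) (p₀ : ℕ → ℕ → P) (𝒮 : StepReading P d)
  (ρ₀ : (K : ℕ) → ℝ → C K 0 → ℝ) (hρ : ∀ K t, (𝒢 K 0).Gd (ρ₀ K t)) (h0 : ∀ K t x, 0 ≤ ρ₀ K t x)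
  (B : ℕ → ℝ → ℝ) (hB : ∀ K t, 0 < B K t)
  (sB : ℕ → ℕ → ℕ → ℝ) (sR : ℕ → ℕ → ℝ) (cΛ M : ℝ) (gs : ℕ → ℕ → ℝ)
  (hc : 0 ≤ cΛ) (hM : 0 ≤ M) (hℓ : ∀ K j, j ≤ K → 0 ≤ ell (gs K) j)

/-- **THE PINNED ENVELOPES OF THE TOWER** — J1's `factorsOf` at the pinned values (volume letter at the reading's own sizes
`𝒮.R`) and J2b's per-step envelope at them. [folklore] -/
def factorsPinned : HistFactors (skelFam T p₀) d :=
  factorsOf T p₀ B (fBexp sB) (fRexp sR) (ΛexpL cΛ M d gs 𝒮.R) (one_le_ΛexpL cΛ M gs 𝒮.R hc hM hℓ)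
    (𝒮.wStep (fBexp sB) (fRexp sR) (ΛexpL cΛ M d gs 𝒮.R))

/-- the pinned bundle's value slots are the pinned values (by `rfl`) [folklore] -/
theorem factorsPinned_values :
    (factorsPinned T p₀ 𝒮 B sB sR cΛ M gs hc hM hℓ).fB = fBexp sB ∧
      (factorsPinned T p₀ 𝒮 B sB sR cΛ M gs hc hM hℓ).fR = fRexp sR ∧
        (factorsPinned T p₀ 𝒮 B sB sR cΛ M gs hc hM hℓ).Λ = ΛexpL cΛ M d gs 𝒮.R :=
  ⟨rfl, rfl, rfl⟩

/-- **M5-3's `FactorRead` FOR THE PINNED BUNDLE OF RUN `K`** at the letters `sB K`, `sR K` (§1, by name). [folklore] -/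
theorem factorRead_factorsPinned (K : ℕ) :
    FactorRead ((factorsPinned T p₀ 𝒮 B sB sR cΛ M gs hc hM hℓ).fB K)
      ((factorsPinned T p₀ 𝒮 B sB sR cΛ M gs hc hM hℓ).fR K) (sB K) (sR K) :=
  factorRead_pinned sB sR K

/-- **THE END RECORD's `hΛL` FOR THE PINNED BUNDLE, BY `Real.log_exp`**: `log (Φf.Λ K t) = uvolL cΛ M d (gs K) (ℛ.R K) K t`
with `Φf :=` the pinned bundle and `ℛ := 𝒮.reading T p₀` (whose sizes ARE `𝒮.R`) — the shape of
`HistoryRealiseCellsRunAssemblyWTVSDataLWL.HistReadDataLWL.hΛL` at `g := gs K`, verbatim. [folklore] -/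
theorem log_Λ_factorsPinned (K t : ℕ) :
    Real.log ((factorsPinned T p₀ 𝒮 B sB sR cΛ M gs hc hM hℓ).Λ K t) =
      uvolL cΛ M d (gs K) ((𝒮.reading T p₀).R K) K t :=
  log_ΛexpL cΛ M gs 𝒮.R K t

/-- **J3 ⟹ R2 IN THE PINNED SHAPE**: from the pinned display `HwPinned`, the sup of the dressed initial density `hBρ`
and «the small-field choice names no region» `hν0`, M2-B's `HistRead` for the tower with J2b's causal reading and the
PINNED factor bundle — J2b's `histRead_tower_of_hw` by name.  No free factor VALUE remains; the exponent letters are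
the count road's own. [folklore] -/
theorem histRead_of_hwPinned {l₀ : ℝ} {K₀ : ℕ} (hw : HwPinned T 𝒮 sB sR cΛ M gs K₀)
    (hBρ : ∀ K t, |t| ≤ l₀ → K₀ ≤ K → ∀ y, |ρ₀ K t y| ≤ B K t) (hν0 : ∀ K j g, 𝒮.ν K j g (p₀ K j) = ∅) :
    HistRead (𝒮.reading T p₀) (factorsPinned T p₀ 𝒮 B sB sR cΛ M gs hc hM hℓ) (reprFam T p₀ ρ₀ hρ h0 B hB)
      l₀ K₀ :=
  𝒮.histRead_tower_of_hw T p₀ ρ₀ hρ h0 B hB _ _ _ _ (fBexp_nonneg sB) (fRexp_nonneg sR) hw hBρ hν0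

/-- **THE WEIGHT OF EVERY TOWER TERM AGAINST THE PINNED EVENT PRODUCTS** — J2b's `weight_le_evProd_of_hw` at the
pinned values, from `HwPinned`, `hBρ`, `hν0`, the geometric condition `hν` on named regions and `Rm ≤ R`. [folklore] -/
theorem weight_le_evProd_of_hwPinned [∀ K, MeasurableSpace (C K K)] (μ : (K : ℕ) → Measure (C K K))
    [∀ K, IsFiniteMeasure (μ K)] {l₀ : ℝ} {K₀ : ℕ} (hw : HwPinned T 𝒮 sB sR cΛ M gs K₀)
    (hBρ : ∀ K t, |t| ≤ l₀ → K₀ ≤ K → ∀ y, |ρ₀ K t y| ≤ B K t) (hν0 : ∀ K j g, 𝒮.ν K j g (p₀ K j) = ∅)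
    (hν : ∀ K j g p, ∀ n ∈ 𝒮.ν K j g p, n.1 ∈ n.2 ∧ FaceConnected n.2 ∧ treeLen n.2 ≤ 𝒮.κ K n)
    (hRm : ∀ K s k, 𝒮.Rm K s k ≤ 𝒮.R K s) {K : ℕ} (hK : K₀ ≤ K) {t : ℝ} (ht : |t| ≤ l₀)
    {τ : HIndex.Idx (skelFam T p₀)} (hτ : τ ∈ HIndex.termSet (skelFam T p₀) K) :
    Repr172R.weight μ (reprFam T p₀ ρ₀ hρ h0 B hB) t τ ≤
      (∏ j ∈ Finset.range (K + 1), ∏ c ∈ ((𝒮.reading T p₀).inputOf.run K τ).histM.comp j,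
          ΛexpL cΛ M d gs 𝒮.R K j ^ (c.2).card) *
        ((∏ c ∈ (𝒮.reading T p₀).inputOf.liveC K τ,
            evProd (fBexp (d := d) sB K) (fRexp sR K) (((𝒮.reading T p₀).inputOf.ped K τ).toPGen id c)) *
          ∏ j ∈ Finset.range K, ∏ c ∈ ((𝒮.reading T p₀).inputOf.run K τ).histM.died j,
            evProd (fBexp (d := d) sB K) (fRexp sR K) (((𝒮.reading T p₀).inputOf.ped K τ).toPGen id (j, c))) *
        (factorsPinned T p₀ 𝒮 B sB sR cΛ M gs hc hM hℓ).rest (fun K => (μ K).real Set.univ) t τ :=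
  𝒮.weight_le_evProd_of_hw T p₀ ρ₀ hρ h0 B hB _ _ _ _ μ (fBexp_nonneg sB) (fRexp_nonneg sR) hw hBρ hν0 hν hRm
    hK ht hτ

end End

end

end Summit.QuantumFields.BalabanUV.T4Continuum.B16HistoryStepDisplayPinned
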